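import Summits.CriticalPhenomena.PercolationContinuityZ3.Theorems.PercNearOneGluingNoHeavyLowerTailAntiBandCylinderShifted

/-!
# `NoHeavyLowerTail` (crux stmt-CriticalPhenomena-4575), lane prim-ineq-gen-4 (gen 34): the PREFIX-CYLINDER decomposition of a left-shifted upper set and
# (AB_l) for every left-shifted `W` whose minimal elements are "ballot"

Support file (`--supports stmt-CriticalPhenomena-4575`; memo `run/shared/lean/prim/prim-ineq-gen-4/FINDING-CYLINDER-g34.md` §2).
No definitions, no `sorry`, standard axioms.

For a left-shifted upper set `W ⊆ 2^{Fin n}` (compressed along `({i},{j})`, `i < j`) every member `x` has exactly one MINIMAL element of `W` among its prefixes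
`{a ∈ x | a ≤ j}`: the shortest prefix lying in `W` (`exists_minimal_prefix`; one left shift shows it is minimal), and two minimal prefixes are nested hence equal.
So `W` is the disjoint union of the Boolean intervals `[m, m ∪ {i | i > max m}]` over its minimal elements `m` — the cylinders of gen 34's `AntiBandCylinder`, with
complement `[0, max m] \ m` = the gaps of `m`.  If every minimal `m` is BALLOT (its gaps inject increasingly into `m`), `AntiBandCylinderShifted.
antiBand_of_dominated_cylinders_all` gives **(AB_l)(W, V) for every upper set `V` and every `l`** (`antiBand_of_ballot_minimals`).  Examples: principal filters,
`Th_k([k+1])` (e.g. `Maj₃`), generator chains `{12, 134, 1456, …}`; non-example: any `W` with a minimal element `[1,k−1] ∪ {j}`, `j ≥ k+2`.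
-/

namespace Summit.CriticalPhenomena.PercolationContinuityZ3.Theorems.AntiBandPrefixCylinders

open Finset
open scoped FinsetFamily

variable {n : ℕ}

/-- **The shortest prefix in `W` is minimal.**  `W` a left-shifted upper set, `x ∈ W`: some minimal element `m` of `W` satisfies `m ⊆ x` and every element of `x \ m`
lies above every element of `m` (i.e. `m` is a prefix of `x`). [this work, memo §2.1] -/
theorem exists_minimal_prefix (W : Finset (Finset (Fin n))) (hW : IsUpperSet (W : Set (Finset (Fin n))))
    (hsh : ∀ i j : Fin n, i < j → UV.IsCompressed ({i} : Finset (Fin n)) {j} W) (x : Finset (Fin n)) (hx : x ∈ W) :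
    ∃ m ∈ W, (∀ m' ∈ W, m' ⊆ m → m' = m) ∧ m ⊆ x ∧ ∀ a ∈ x, a ∉ m → ∀ b ∈ m, b < a := by
  classical
  by_cases h0 : (∅ : Finset (Fin n)) ∈ W
  · exact ⟨∅, h0, fun m' _ hm' => subset_empty.1 hm', empty_subset x, fun a _ _ b hb => absurd hb (notMem_empty b)⟩
  -- the elements `j ∈ x` whose prefix `{a ∈ x | a ≤ j}` lies in `W`
  set T := x.filter fun j => x.filter (fun a => a ≤ j) ∈ W with hT
  have hxne : x.Nonempty := by rw [nonempty_iff_ne_empty]; rintro rfl; exact h0 hx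
  have hTne : T.Nonempty := by
    refine ⟨x.max' hxne, mem_filter.2 ⟨max'_mem x hxne, ?_⟩⟩
    rw [filter_true_of_mem fun a ha => le_max' x a ha]; exact hx
  set j₀ := T.min' hTne with hj₀
  have hj₀T : j₀ ∈ T := min'_mem T hTne
  rw [hT, mem_filter] at hj₀T
  set m := x.filter fun a => a ≤ j₀ with hm
  have hj₀m : j₀ ∈ m := mem_filter.2 ⟨hj₀T.1, le_rfl⟩
  have hmW : m ∈ W := hj₀T.2
  -- `m.erase j₀ ∉ W`
  have herase : m.erase j₀ ∉ W := by
    intro hW'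
    by_cases hem : (m.erase j₀).Nonempty
    · set j' := (m.erase j₀).max' hem with hj'
      have hj'm : j' ∈ m.erase j₀ := max'_mem _ hem
      rw [mem_erase, hm, mem_filter] at hj'm
      have hj'lt : j' < j₀ := lt_of_le_of_ne hj'm.2.2 hj'm.1
      have heq : m.erase j₀ = x.filter fun a => a ≤ j' := by
        ext a
        rw [mem_erase, hm, mem_filter, mem_filter]
        constructor
        · rintro ⟨h1, h2, h3⟩
          exact ⟨h2, le_max' _ a (mem_erase.2 ⟨h1, mem_filter.2 ⟨h2, h3⟩⟩)⟩
        · rintro ⟨h1, h2⟩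
          exact ⟨fun h => absurd (h ▸ h2) (not_le.2 hj'lt), h1, h2.trans hj'lt.le⟩
      have hj'T : j' ∈ T := by rw [hT, mem_filter]; exact ⟨hj'm.2.1, heq ▸ hW'⟩
      exact absurd (min'_le T j' hj'T) (not_le.2 hj'lt)
    · rw [not_nonempty_iff_eq_empty] at hem; rw [hem] at hW'; exact h0 hW'
  refine ⟨m, hmW, fun m' hm'W hm'm => ?_, filter_subset _ _, fun a hax ham b hb => ?_⟩
  · -- minimality: a proper subset `m' ∈ W` misses some `i ∈ m`; then `m.erase i ∈ W` and a left shift gives `m.erase j₀ ∈ W`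
    by_contra hne
    obtain ⟨i, him, him'⟩ := exists_of_ssubset (lt_of_le_of_ne hm'm hne)
    have hiW : m.erase i ∈ W := hW (fun a ha => mem_erase.2 ⟨fun h => him' (h ▸ ha), hm'm ha⟩ : m' ⊆ m.erase i) hm'W
    by_cases hij : i = j₀
    · exact herase (hij ▸ hiW)
    · have hi' : i < j₀ := lt_of_le_of_ne (mem_filter.1 him).2 hij
      have h := AntiBandCylinder.insert_erase_mem_of_isCompressed (hsh i j₀ hi') hiW
        (mem_erase.2 ⟨fun h => hij h.symm, hj₀m⟩) (fun h => (mem_erase.1 h).1 rfl)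
      have heq : insert i ((m.erase i).erase j₀) = m.erase j₀ := by
        ext a; rw [mem_insert, mem_erase, mem_erase, mem_erase]
        constructor
        · rintro (h1 | ⟨h1, h2, h3⟩)
          · exact ⟨fun h => hij (h1 ▸ h), h1 ▸ him⟩
          · exact ⟨h1, h3⟩
        · rintro ⟨h1, h2⟩; by_cases hai : a = i; exacts [Or.inl hai, Or.inr ⟨h1, hai, h2⟩]
      exact herase (heq ▸ h)
  · rw [hm, mem_filter] at hb ham
    push Not at ham
    exact lt_of_le_of_lt hb.2 (ham hax)

/-- **(AB_l) for left-shifted upper sets with ballot minimal elements.**  Let `W ⊆ 2^{Fin n}` be an upper set compressed along `({i},{j})` for all `i < j`, and suppose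
every minimal element `m` of `W` is BALLOT: there is a map `π`, injective on the gaps `{i ∉ m | ∃ j ∈ m, i < j}` of `m`, sending each gap `i` to an element `π i ∈ m` with
`i < π i`.  Then for every upper set `V` and every `l`: `#{s ∈ W ∩ Vᶜˢ | #s < l ∨ #sᶜ < l} ≤ #{s ∈ W ∩ V | #s < l ∨ #sᶜ < l}` (the prefix cylinders
`[m, m ∪ {i | i > max m}]` partition `W` and are dominated). [this work, memo §2] -/
theorem antiBand_of_ballot_minimals (l : ℕ) (W : Finset (Finset (Fin n))) (hW : IsUpperSet (W : Set (Finset (Fin n))))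
    (hsh : ∀ i j : Fin n, i < j → UV.IsCompressed ({i} : Finset (Fin n)) {j} W)
    (hball : ∀ m ∈ W, (∀ m' ∈ W, m' ⊆ m → m' = m) → ∃ π : Fin n → Fin n,
      (∀ i, i ∉ m → (∃ j ∈ m, i < j) → π i ∈ m ∧ i < π i) ∧ Set.InjOn π {i | i ∉ m ∧ ∃ j ∈ m, i < j})
    (V : Finset (Finset (Fin n))) (hV : IsUpperSet (V : Set (Finset (Fin n)))) :
    #((W ∩ Vᶜˢ).filter fun s => #s < l ∨ #sᶜ < l) ≤ #((W ∩ V).filter fun s => #s < l ∨ #sᶜ < l) := by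
  classical
  -- the top of the cylinder of `m`: `m` together with everything above all of `m`
  set top : Finset (Fin n) → Finset (Fin n) := fun m => m ∪ univ.filter fun i => ∀ j ∈ m, j < i with htop
  have hmemtop : ∀ m i, i ∈ top m ↔ i ∈ m ∨ ∀ j ∈ m, j < i := fun m i => by
    rw [htop, mem_union, mem_filter]; simp only [mem_univ, true_and]
  have hcompl : ∀ m i, i ∈ (top m)ᶜ ↔ i ∉ m ∧ ∃ j ∈ m, i < j := by
    intro m i; rw [mem_compl, hmemtop, not_or, not_forall]
    constructor
    · rintro ⟨h1, j, hj⟩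
      rw [Classical.not_imp, not_lt] at hj
      exact ⟨h1, j, hj.1, lt_of_le_of_ne hj.2 fun h => h1 (h ▸ hj.1)⟩
    · rintro ⟨h1, j, hj, hij⟩; exact ⟨h1, j, fun h => absurd (h hj) (not_lt.2 hij.le)⟩
  set Mins := W.filter fun m => ∀ m' ∈ W, m' ⊆ m → m' = m with hMins
  set P : Finset (Finset (Fin n) × Finset (Fin n)) := Mins.image fun m => (m, top m) with hP
  have hPmem : ∀ p, p ∈ P ↔ ∃ m ∈ Mins, (m, top m) = p := fun p => by rw [hP, mem_image]
  refine AntiBandCylinderShifted.antiBand_of_dominated_cylinders_all l W hsh P ?_ ?_ ?_ V hV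
  · -- each cylinder: `m ⊆ top m` and a domination from the ballot map
    intro p hp
    obtain ⟨m, hm, rfl⟩ := (hPmem p).1 hp
    rw [hMins, mem_filter] at hm
    obtain ⟨π, hπ, hinj⟩ := hball m hm.1 hm.2
    refine ⟨subset_union_left, π, fun i hi => ?_, fun i hi i' hi' h => ?_⟩
    · obtain ⟨h1, h2⟩ := (hcompl m i).1 hi; exact hπ i h1 h2
    · exact hinj ((hcompl m i).1 hi) ((hcompl m i').1 hi') h
  · -- two cylinders sharing a point come from nested, hence equal, minimal elements
    intro p hp p' hp' hne x _ h1 h2 h1' h2'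
    obtain ⟨m, hm, rfl⟩ := (hPmem p).1 hp
    obtain ⟨m', hm', rfl⟩ := (hPmem p').1 hp'
    rw [hMins, mem_filter] at hm hm'
    apply hne
    have key : ∀ (a b : Finset (Fin n)), (∀ c ∈ W, c ⊆ a → c = a) → b ∈ W → a ⊆ x → x ⊆ top a → b ⊆ x → x ⊆ top b → a ⊆ b := by
      intro a b hamin hbW hax hxa hbx hxb i hia
      by_contra hib
      have hi := (hmemtop b i).1 (hxb (hax hia))
      rcases hi with hi | hi
      · exact hib hi
      · -- `i` lies above all of `b`; then `b ⊆ a`, so `b = a`, contradiction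
        have hba : b ⊆ a := by
          intro j hjb
          rcases (hmemtop a j).1 (hxa (hbx hjb)) with hj | hj
          · exact hj
          · exact absurd (hi j hjb) (not_lt.2 (hj i hia).le)
        exact hib (by rw [hamin b hbW hba]; exact hia)
    have e1 := key m m' hm.2 hm'.1 h1 h2 h1' h2'
    have e2 := key m' m hm'.2 hm.1 h1' h2' h1 h2
    rw [subset_antisymm e1 e2]
  · -- cover: `x ∈ W` iff some minimal prefix cylinder contains it
    intro x _
    constructor
    · intro hx
      obtain ⟨m, hmW, hmin, hmx, habove⟩ := exists_minimal_prefix W hW hsh x hx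
      refine ⟨(m, top m), (hPmem _).2 ⟨m, by rw [hMins, mem_filter]; exact ⟨hmW, hmin⟩, rfl⟩, hmx, fun a ha => ?_⟩
      rw [hmemtop]
      by_cases ham : a ∈ m; exacts [Or.inl ham, Or.inr (habove a ha ham)]
    · rintro ⟨p, hp, h1, -⟩
      obtain ⟨m, hm, rfl⟩ := (hPmem p).1 hp
      rw [hMins, mem_filter] at hm
      exact hW h1 hm.1

end Summit.CriticalPhenomena.PercolationContinuityZ3.Theorems.AntiBandPrefixCylinders
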